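import Mathlib
import Summits.AnomalousDissipation.AnomalousDissipation.Theses.WazewskiBlock
import Literature.Analysis.FluidPDE.GalerkinFlow

/-!
# Sketch — crux-ideate stmt-AnomalousDissipation-10353 (`WazewskiBlock.UniformWorkFloorTrap`), ideator 1, round 1

First lemmas of the two idea cards, stated as `Prop`s over existing declarations (no `sorry`):

* vocabulary `IsForce`, `IsGalerkinField`, `IsTrajectory`, `TrappedIn` = the crux's clauses verbatim,
  and `crux_iff` (`Iff.rfl`);
* card `boundary-degree-readout`: `WorkAccelerationEmptiesBlock`, `StressThresholdEmptiesBlock`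
  (emptiness of the block below the stress threshold `E_c(f) = ‖f‖²/(2σ*(f))`), `SteadyStateIsTrapped`
  (a zero of the Galerkin field inside the block is a constant trapped trajectory), `ShearSectorIsLaminar`
  (the fixed sector of the translation torus of a shear force carries only the laminar state, whose energy
  is `≥ ‖f‖²/(2ν²(4π²m²)²)` — the analytic input of the equivariant-degree kill);
* card `work-lipschitz-cycles`: `WorkFallRate` (the work functional falls no faster than the ν-free stress
  budget `D`), `WindowedFloorGivesPointwise`, `PeriodicWitness`.
-/

namespace Summit.AnomalousDissipation.AnomalousDissipation.Cruxes.UniformWorkFloorTrap.SketchIdeator1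

open scoped InnerProductSpace RealInnerProductSpace ENNReal
open MeasureTheory Filter Set
open Literature.Analysis.FunctionSpaces Literature.Analysis.FunctionSpaces.Torus
open Literature.Analysis.FluidPDE
open Summit.AnomalousDissipation.AnomalousDissipation.Theses.WazewskiBlock (UniformWorkFloorTrap)

/-- `T³`. -/
abbrev T3 := UnitAddTorus (Fin 3)
/-- `ℝ³`. -/
abbrev E3 := EuclideanSpace ℝ (Fin 3)

/-- Galerkin field of order `N` (verbatim the crux's test-field / slice clause: smooth, divergence free,
Fourier support in `|k|² ≤ N²`). -/
def IsGalerkinField (N : ℕ) (a : T3 → E3) : Prop :=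
  IsSmooth a ∧ IsDivFree a ∧ ∀ k : Fin 3 → ℤ, ((N : ℕ) : ℝ) ^ 2 < freqNormSq k →
    UnitAddTorus.mFourierCoeff (Literature.Analysis.FunctionSpaces.EuclideanSpace.complexify ∘ a) k = 0

/-- The crux's force clause: a mean-zero Galerkin field of order `m`. -/
def IsForce (m : ℕ) (f : T3 → E3) : Prop :=
  IsGalerkinField m f ∧ HasZeroMean f

/-- Clauses (1)–(4) of the crux's `∃ U` body: a global Galerkin trajectory of order `N` at viscosity `ν`
driven by `f` (joint continuity, Galerkin + weakly div-free slices, tested Galerkin equations, exact energy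
identity). Every forward orbit of `Torus.galerkinFlow ν f N` satisfies them
(`IsGalerkinMode.galerkinFlow_clauses`). -/
def IsTrajectory (ν : ℝ) (N : ℕ) (f : T3 → E3) (U : ℝ → T3 → E3) : Prop :=
  ContinuousOn (stLift U) (Set.Ici 0 ×ˢ Set.univ) ∧
  (∀ t : ℝ, 0 ≤ t → IsGalerkinField N (U t) ∧ IsWeaklyDivFree (U t)) ∧
  (∀ a : T3 → E3, IsGalerkinField N a → ∀ s t : ℝ, 0 ≤ s → s ≤ t →
    (∫ x, inner ℝ (U t x) (a x)) - ∫ x, inner ℝ (U s x) (a x) =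
      ∫ τ in s..t, ∫ x, (inner ℝ (U τ x) (convect (U τ) a x) + ν * inner ℝ (U τ x) (laplacian a x) +
        inner ℝ (f x) (a x))) ∧
  (∀ s t : ℝ, 0 ≤ s → s ≤ t → kineticEnergy (U t) + ν * (∫⁻ τ in Set.Ioo s t, eGradNormSq (U τ)).toReal =
    kineticEnergy (U s) + ∫ τ in s..t, ∫ x, inner ℝ (f x) (U τ x))

/-- Clause (5): trapped for all `t ≥ 0` in the block `{KE ≤ E} ∩ {(f, ·) ≥ ε₀}`. -/
def TrappedIn (E ε₀ : ℝ) (f : T3 → E3) (U : ℝ → T3 → E3) : Prop :=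
  ∀ t : ℝ, 0 ≤ t → kineticEnergy (U t) ≤ E ∧ ε₀ ≤ ∫ x, inner ℝ (f x) (U t x)

/-- The crux, unfolded into the vocabulary above (definitional). -/
theorem crux_iff : UniformWorkFloorTrap ↔
    ∃ (m : ℕ) (f : T3 → E3), IsGalerkinField m f ∧ HasZeroMean f ∧ ∃ (E ε₀ ν₀ : ℝ), 0 < ε₀ ∧ 0 < ν₀ ∧
      ∀ ν : ℝ, 0 < ν → ν ≤ ν₀ → ∃ N₀ : ℕ, ∀ N : ℕ, N₀ ≤ N → ∃ U : ℝ → T3 → E3,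
        IsTrajectory ν N f U ∧ TrappedIn E ε₀ f U :=
  Iff.rfl

/-! ## Card `boundary-degree-readout` -/

/-- **Uniform work acceleration empties the block.** If on the whole energy ball `{KE ≤ E}` (Galerkin
fields of order `N`) the instantaneous rate of change of the work, `∫⟪V,(V·∇)f⟫ + ν∫⟪V,Δf⟫ + ‖f‖²`
(the tested Galerkin identity with the admissible test field `a = f`, `m ≤ N`), is `≥ δ > 0`, then no
Galerkin trajectory of order `N` is trapped in `{KE ≤ E, (f,·) ≥ ε₀}`: the work would grow linearly
while `(f, U t) ≤ ‖f‖ (2E)^{1/2}`. Provable now (S). -/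
def WorkAccelerationEmptiesBlock : Prop :=
  ∀ (ν : ℝ) (m N : ℕ) (f : T3 → E3) (E ε₀ δ : ℝ) (U : ℝ → T3 → E3),
    IsForce m f → m ≤ N → 0 < δ → IsTrajectory ν N f U →
    (∀ V : T3 → E3, IsGalerkinField N V → kineticEnergy V ≤ E →
      δ ≤ (∫ x, inner ℝ (V x) (convect V f x)) + ν * (∫ x, inner ℝ (V x) (laplacian f x)) +
        ∫ x, ‖f x‖ ^ 2) →
    ¬ TrappedIn E ε₀ f U

/-- **The stress threshold.** `⟪w, Df(x) w⟫ = w·S_f(x)·w` is the Reynolds stress of the direction `w`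
against the strain of the force; if `-S_f ≤ σ` pointwise then `∫⟪V,(V·∇)f⟫ ≥ -2σ·KE(V)`, so for
`2σE + ν (2E)^{1/2} ‖Δf‖₂ < ‖f‖₂²` the block `{KE ≤ E, (f,·) ≥ ε₀}` contains no trapped Galerkin trajectory
of any order `N ≥ m`, at any such `ν ≥ 0`: witnesses need `E ≥ E_c(f) := ‖f‖₂²/(2σ*(f))` up to `O(ν)`
(`σ*(f) = max_x λ_max(-S_f(x))`; Kolmogorov `F sin(2πm x₁) e₂`: `σ* = πmF`, `E_c = F/(4πm)`). Provable now (S). -/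
def StressThresholdEmptiesBlock : Prop :=
  ∀ (ν : ℝ) (m N : ℕ) (f : T3 → E3) (E ε₀ σ : ℝ) (U : ℝ → T3 → E3),
    IsForce m f → m ≤ N → 0 ≤ ν → 0 ≤ E → IsTrajectory ν N f U →
    (∀ (x : T3) (w : E3), -(σ * ‖w‖ ^ 2) ≤ inner ℝ w (convect (fun _ => w) f x)) →
    2 * σ * E + ν * Real.sqrt (2 * E) * Real.sqrt (∫ x, ‖laplacian f x‖ ^ 2) < ∫ x, ‖f x‖ ^ 2 →
    ¬ TrappedIn E ε₀ f U

/-- **A zero of the Galerkin field inside the block is a (constant) trapped trajectory.** A Galerkin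
steady state of order `N` — tested steady equations against all Galerkin fields of order `N` — with
`KE ≤ E` and `(f, U) ≥ ε₀` satisfies clauses (1)–(5) as the constant trajectory (energy identity:
`ν‖∇U‖² = (f,U)` from the test `a = U`). This is how a nonzero Brouwer degree of the Galerkin field on the
block (or a nonzero equivariant degree on the orbit space) is cashed in. Provable now (M). -/
def SteadyStateIsTrapped : Prop :=
  ∀ (ν : ℝ) (N : ℕ) (f : T3 → E3) (E ε₀ : ℝ) (Us : T3 → E3),
    0 ≤ ν → IsSmooth f → IsGalerkinField N Us → HasZeroMean Us →
    (∀ a : T3 → E3, IsGalerkinField N a →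
      ∫ x, (inner ℝ (Us x) (convect Us a x) + ν * inner ℝ (Us x) (laplacian a x) + inner ℝ (f x) (a x)) = 0) →
    kineticEnergy Us ≤ E → ε₀ ≤ ∫ x, inner ℝ (f x) (Us x) →
    IsTrajectory ν N f (fun _ => Us) ∧ TrappedIn E ε₀ f (fun _ => Us)

/-- **The fixed sector of the translation torus of a shear force is laminar.** Let the force be a shear
field (invariant under all translations in `x₂` and `x₃`; mean zero and divergence free force `f₁ = 0`).
Every `x₂,x₃`-invariant mean-zero Galerkin steady state `U` of order `N ≥ m` is then a parallel shear flow
with `(U·∇)U = 0`, hence solves `νΔU + f = 0`: it is the laminar state, of energy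
`½ ∑ |f̂ₖ|²/(ν²(4π²|k|²)²) ≥ ‖f‖₂²/(2ν²(4π²m²)²)`. Consequence (topological input, to be vendored: the
Brouwer degree of a torus-equivariant field equals the degree of its restriction to the fixed sector):
for `E < ‖f‖₂²/(2ν²(4π²m²)²)` the Galerkin field has DEGREE ZERO on every translation-invariant body
`B ⊆ {KE ≤ E}` with no steady state on `∂B` — loud bounded steady states of Kolmogorov-forced Galerkin
systems are degree-invisible (index-cancelling), at every `N`. Provable now (M). -/
def ShearSectorIsLaminar : Prop :=
  ∀ (ν : ℝ) (m N : ℕ) (f U : T3 → E3), 0 < ν → IsForce m f → m ≤ N →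
    (∀ (s : UnitAddCircle) (x : T3), f (x + Pi.single (1 : Fin 3) s) = f x ∧ f (x + Pi.single (2 : Fin 3) s) = f x) →
    IsGalerkinField N U → HasZeroMean U →
    (∀ (s : UnitAddCircle) (x : T3), U (x + Pi.single (1 : Fin 3) s) = U x ∧ U (x + Pi.single (2 : Fin 3) s) = U x) →
    (∀ a : T3 → E3, IsGalerkinField N a →
      ∫ x, (inner ℝ (U x) (convect U a x) + ν * inner ℝ (U x) (laplacian a x) + inner ℝ (f x) (a x)) = 0) →
    (∀ x, ν • laplacian U x + f x = 0) ∧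
      (∫ x, ‖f x‖ ^ 2) ≤ 2 * ν ^ 2 * (4 * Real.pi ^ 2 * (m : ℝ) ^ 2) ^ 2 * kineticEnergy U

/-! ## Card `work-lipschitz-cycles` -/

/-- **The work functional falls no faster than the stress budget.** Along a Galerkin trajectory whose
energy stays `≤ E` on `[s, t]`, `(f, U t) - (f, U s) ≥ -D (t - s)` whenever `-D` bounds from below the
instantaneous work rate `∫⟪V,(V·∇)f⟫ + ν∫⟪V,Δf⟫ + ‖f‖²` on the energy ball; with the stress threshold,
`D = (2σ*(f)E - ‖f‖₂²)₊ + ν(2E)^{1/2}‖Δf‖₂` works — a `ν`- and `N`-free FALL RATE that vanishes at the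
emptiness threshold `E = E_c(f)`. Provable now (S: fundamental theorem of calculus on the tested identity
with `a = f`). -/
def WorkFallRate : Prop :=
  ∀ (ν : ℝ) (m N : ℕ) (f : T3 → E3) (E D : ℝ) (U : ℝ → T3 → E3) (s t : ℝ),
    IsForce m f → m ≤ N → IsTrajectory ν N f U → 0 ≤ s → s ≤ t →
    (∀ τ ∈ Set.Icc s t, kineticEnergy (U τ) ≤ E) →
    (∀ V : T3 → E3, IsGalerkinField N V → kineticEnergy V ≤ E →
      -D ≤ (∫ x, inner ℝ (V x) (convect V f x)) + ν * (∫ x, inner ℝ (V x) (laplacian f x)) +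
        ∫ x, ‖f x‖ ^ 2) →
    -(D * (t - s)) ≤ (∫ x, inner ℝ (f x) (U t x)) - ∫ x, inner ℝ (f x) (U s x)

/-- **Windowed floors are pointwise floors.** If every past window `[t - τ, t]` (`t ≥ τ`) has mean work
`≥ w̄`, then `(f, U t) ≥ w̄ - Dτ/2` for all `t ≥ τ` (`D` the fall rate of `WorkFallRate`): the crux's
POINTWISE clause is equivalent, up to the explicit `ν`-free loss `Dτ/2`, to a short-window Cesàro clause
(which is weakly closed and measure-friendly). Provable now (S). -/
def WindowedFloorGivesPointwise : Prop :=
  ∀ (ν : ℝ) (m N : ℕ) (f : T3 → E3) (E D τ wbar : ℝ) (U : ℝ → T3 → E3),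
    IsForce m f → m ≤ N → IsTrajectory ν N f U → 0 < τ → 0 ≤ D →
    (∀ t : ℝ, 0 ≤ t → kineticEnergy (U t) ≤ E) →
    (∀ V : T3 → E3, IsGalerkinField N V → kineticEnergy V ≤ E →
      -D ≤ (∫ x, inner ℝ (V x) (convect V f x)) + ν * (∫ x, inner ℝ (V x) (laplacian f x)) +
        ∫ x, ‖f x‖ ^ 2) →
    (∀ t : ℝ, τ ≤ t → wbar ≤ τ⁻¹ * ∫ s in (t - τ)..t, ∫ x, inner ℝ (f x) (U s x)) →
    ∀ t : ℝ, τ ≤ t → wbar - D * τ / 2 ≤ ∫ x, inner ℝ (f x) (U t x)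

/-- **Loud short cycles are pointwise loud.** A time-periodic Galerkin trajectory (period `T`) with
`KE ≤ E` over a period and mean work over a period `≥ ε₀ + D·T` (`D` the fall rate) is trapped in
`{KE ≤ E, (f,·) ≥ ε₀}` for all `t ≥ 0`: `min W ≥ max W - DT ≥ mean W - DT`. With hyperbolic persistence
under Galerkin refinement (card, stub for crux-plan) this turns ONE loud cycle of `NS_ν` per viscosity into
the crux's `∀ N ≥ N₀(ν)`. Provable now (S/M). -/
def PeriodicWitness : Prop :=
  ∀ (ν : ℝ) (m N : ℕ) (f : T3 → E3) (E ε₀ D T : ℝ) (U : ℝ → T3 → E3),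
    IsForce m f → m ≤ N → IsTrajectory ν N f U → 0 < T → 0 ≤ D →
    (∀ t : ℝ, 0 ≤ t → U (t + T) = U t) →
    (∀ t ∈ Set.Icc 0 T, kineticEnergy (U t) ≤ E) →
    (∀ V : T3 → E3, IsGalerkinField N V → kineticEnergy V ≤ E →
      -D ≤ (∫ x, inner ℝ (V x) (convect V f x)) + ν * (∫ x, inner ℝ (V x) (laplacian f x)) +
        ∫ x, ‖f x‖ ^ 2) →
    ε₀ + D * T ≤ T⁻¹ * ∫ t in (0 : ℝ)..T, ∫ x, inner ℝ (f x) (U t x) →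
    TrappedIn E ε₀ f U

/-- Sanity: the steady lemma feeds the crux's inner existential at one `(ν, N)`. -/
theorem trapped_of_steady (h : SteadyStateIsTrapped) {ν : ℝ} {N : ℕ} {f : T3 → E3} {E ε₀ : ℝ}
    {Us : T3 → E3} (hν : 0 ≤ ν) (hf : IsSmooth f) (hU : IsGalerkinField N Us) (hU0 : HasZeroMean Us)
    (hsteady : ∀ a : T3 → E3, IsGalerkinField N a →
      ∫ x, (inner ℝ (Us x) (convect Us a x) + ν * inner ℝ (Us x) (laplacian a x) + inner ℝ (f x) (a x)) = 0)
    (hE : kineticEnergy Us ≤ E) (hW : ε₀ ≤ ∫ x, inner ℝ (f x) (Us x)) :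
    ∃ U : ℝ → T3 → E3, IsTrajectory ν N f U ∧ TrappedIn E ε₀ f U :=
  ⟨fun _ => Us, h ν N f E ε₀ Us hν hf hU hU0 hsteady hE hW⟩

end Summit.AnomalousDissipation.AnomalousDissipation.Cruxes.UniformWorkFloorTrap.SketchIdeator1
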